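import Literature.Geometry.Lorentzian.PenroseRigidity
import Literature.Geometry.Lorentzian.ConformalFlow
import HarnessLib

/-!
# The case of equality along Bray's conformal flow: `ℰ(Σ⁺(0), g₀) = 2 m(0)` from (226), the
# derivative formula of §7 and the constancy of `A(t)` (Bray 2001, §13), proved as the assembly
# of the named fact `Bray2001_capacity_eq_of_penrose_eq`

Bray, J. Differential Geom. 59 (2001) 177–267 (arXiv:math/9911173, same numbering), §13, proof
of the case of equality of Thm. 1 (the paragraph following Thm. 18): *"If we have equality in
the Riemannian Penrose inequality, then applying the conformal flow of metrics to this initial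
metric must also give equality in inequality (226) [`m(t) ≥ √(A(t)/16π)`] for all `t ≥ 0`.
Hence, the right hand derivative of `m(t)` at `t = 0` equals zero, so by [the derivative formula
of §7, the display preceding Thm. 10: `d m/dt^±|_{t=0} = ℰ(Σ^±(0), g₀) - 2 m(0)`],
`ℰ(Σ⁺(0), g₀) = 2 m(0)`. By definition 11 [and the flow equation of §4], `Σ⁺(0)` is the
outermost minimal area enclosure of `Σ₀` in `(M³, g)`."*

`PenroseRigidity.lean` vendors the conclusion of this paragraph for exterior regions as the
**named fact** `Bray2001_capacity_eq_of_penrose_eq` (`ℰ(∂M', g)/2 = m`), resting on Thm. 18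
(Thms. 2–3 — existence of the flow, `A(t)` constant, `m(t)` nonincreasing — hold for
asymptotically flat manifolds), on (226), and on the derivative formula of §7. Those three
analytic inputs are theories of their own (§§4–5 and App. A; §§8–12 with Lemma 1; §7 with §6
(86)–(87)) and are not vendored in the tree (`ConformalFlow.lean`, "What is not vendored here,
and why"). This file proves **the paragraph itself** on top of the flow vocabulary of
`ConformalFlow.lean` (`IsConformalFlow`, `flowArea`), taking exactly those inputs, for the data at
hand, as hypotheses — as `rpi_harmonicallyFlat_of_hasConformalFlowHF` does for the inequality:

* `IsConformalHorizonOutside.isMinimalSurfaceImage_frontier` — a horizon of `(X, 1⁴ h)` of class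
  `𝒮` with nonempty boundary is the image of a compact immersed minimal surface
  (`IsMinimalSurfaceImage`, Huisken–Ilmanen's objects of §4); hence
  `IsConformalFlow.isMinimalSurfaceImage_frontier_zero`: so is `Σ(0) = Σ⁺(0)`, the outermost
  minimal area enclosure of `Σ₀` in `g₀` (Thm. 2 at `t = 0`, `u₀ ≡ 1`; §4 Thm. 7).
* `IsConformalFlow.init_eq_zero_of_forall_isMinimalSurfaceImage` — **`Σ(0) = Σ₀` for an
  exterior region**: if `Σ₀ = ∂U₀` with `U₀` connected and every image of a compact immersed
  minimal surface in `closure U₀` lies in `∂U₀` (the exterior-region hypothesis (iii) of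
  `Bray2001_capacity_eq_of_penrose_eq`), then `U 0 = U₀`: `Σ(0) ⊆ closure U₀` is such an image,
  so `Σ(0) ⊆ ∂U₀`, and the nonempty open `U 0 ⊆ U₀` is closed in the connected `U₀`.
* `eq_zero_of_hasDerivWithinAt_of_antitoneOn` — the calculus of the paragraph: a function
  nonincreasing on `[0, ∞)` which is bounded below by its initial value there is constant, so
  its right-hand derivative at `0`, if it exists, vanishes.
* `half_eq_of_hasDerivWithinAt_of_penrose_eq` — the arithmetic of the paragraph: `A(t) = A₀`,
  `m` nonincreasing on `[0, ∞)`, (226) `m(t) ≥ √(A(t)/16π)`, `d m/dt⁺|_{t=0} = c - 2 m(0)` (§7)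
  and equality `√(A₀/16π) = m(0)` force `c = 2 m(0)`.
* `IsConformalFlow.horizonCapacity_toReal_div_two_eq_of_forall_isMinimalSurfaceImage` —
  **`ℰ(Σ⁺(0), g₀) = 2 m(0)` with `Σ⁺(0) = Σ₀`**: for a flow `(u_t, v_t, Σ(t))` from `Σ₀ = ∂U₀`
  as in Thm. 2 with `A(t) = |Σ₀|_{g₀}` (Thm. 3 with §4 Lemma 5), total masses `m(t)`
  nonincreasing on `[0, ∞)` (Thm. 3) satisfying (226) and the derivative formula of §7
  `d m/dt⁺|_{t=0} = ℰ(Σ⁺(0), g₀) - 2 m(0)` (`ℰ = horizonCapacity`, Def. 17, of the outside `U 0`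
  of `Σ(0) = Σ⁺(0)`), under hypothesis (iii) for the connected `U₀` (so `Σ(0) = Σ₀`), equality
  `√(|Σ₀|_{g₀}/16π) = m(0)` forces `(horizonCapacity h e U₀).toReal / 2 = m 0`;
  `IsConformalFlow.horizonCapacity_toReal_div_two_eq_of_isStrictlyOuterMinimizing` — the same
  when instead `Σ₀ ∈ 𝒮` is strictly outer-minimizing (§3: then `Σ(0) = Σ₀`).
* `horizonCapacity_toReal_div_two_eq_admEnergy_of_isConformalFlow` — **the assembly in the
  exterior-region encoding of `Bray2001_capacity_eq_of_penrose_eq`**: for an exterior region `U`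
  with compact minimal boundary `∂U = range B.f` satisfying (iii), equality
  `√(|Σ₀|/16π) = m := e.admEnergy D` for a surface of area `|Σ₀| ≤ |∂U|` (for `Σ₀` smoothly
  embedded into `∂U` this is the area formula, Federer 1969, §3.2.46, with monotonicity), and a
  flow from `∂U` with the properties delivered by Thm. 18, (226) and §7 (with `m(0) = m`, the
  ADM mass (225) of `g₀ = h`), give `(horizonCapacity D.h e U).toReal / 2 = e.admEnergy D` — the
  conclusion of the named fact. What separates this theorem from a discharge
  `Bray2001_capacity_eq_of_penrose_eq_holds` is thus exactly: the existence of the flow for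
  asymptotically flat data started at `∂U ∈ 𝒮` (Thm. 18 with Thm. 2; `∂U ∈ 𝒮` being the
  one-sidedness `Bray2001_oneSided_of_penrose_eq`), the constancy of `A(t)` and monotonicity of
  the ADM masses `m(t)` (Thm. 18 with Thm. 3), inequality (226) along the flow, the derivative
  formula of §7, and the area formula for `Σ₀ ⊆ ∂U`.

Everything here is proved; no definitions and no named facts are introduced.

## References

* H. L. Bray, *Proof of the Riemannian Penrose inequality using the positive mass theorem*,
  J. Differential Geom. 59 (2001) 177–267 (arXiv:math/9911173): §3 (the flow, Thms. 2–3,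
  Def. 7); §4 Def. 11, Thm. 7; §6 Def. 17; §7, Cor. 4, the derivative formula
  `d m/dt^± |_{t=0} = ℰ(Σ^±(0), g₀) - 2m(0)` (the display preceding Thm. 10) and Thm. 10; §13
  Thm. 18, (226), and the proof of the case of equality (p. 240) (key `BrayRPI2001`).
* G. Huisken, T. Ilmanen, *The inverse mean curvature flow and the Riemannian Penrose
  inequality*, J. Differential Geom. 59 (2001) 353–437, §4 (images of compact immersed minimal
  surfaces; exterior regions) (key `HuiskenIlmanenIMCF2001`).
* H. Federer, *Geometric Measure Theory*, Springer 1969, §3.2.46 (area of an embedded surface).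
-/

noncomputable section

open Bundle Set Manifold TopologicalSpace Filter MeasureTheory
open scoped ContDiff Topology ENNReal Manifold Real

namespace Literature.Geometry.Lorentzian

open PseudoRiemannianMetric

variable {X : Type} [TopologicalSpace X] [ChartedSpace E3 X] [IsManifold (𝓡 3) ∞ X]

/-! ### `Σ(0)` is the image of a compact minimal surface; `Σ(0) = Σ₀` for exterior regions -/

section Initial

variable {h : ContMDiffRiemannianMetric (𝓡 3) ∞ E3 (TangentSpace (𝓡 3) : X → Type _)}
  [(ofRiemannian h).HasLeviCivita] {e : AFEnd X}

/-- **A horizon of `(X, h)` of class `𝒮` is the image of a compact immersed minimal surface.**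
If `frontier V` is a smooth horizon of `(X, 1⁴ h) = (X, h)` of class `𝒮` with outside region `V`
(`IsConformalHorizonOutside h 1 e V`: a compact surface `S'` smoothly embedded by `f'` onto
`frontier V`, with smooth `h`-unit normal `ν'` and vanishing conformal mean curvature for the
factor `1`, i.e. `H = 0`, `isConformalHorizon_one_iff`) and `frontier V ≠ ∅`, then `frontier V`
is an `IsMinimalSurfaceImage` of `(X, h)` (Huisken–Ilmanen 2001, §4: "the images of all smooth,
compact, immersed minimal surfaces"). Bray 2001, §2 Defs. 3–4.
[cite: BrayRPI2001, §2 Defs. 3–4] [cite: HuiskenIlmanenIMCF2001, §4] -/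
theorem IsConformalHorizonOutside.isMinimalSurfaceImage_frontier {V : Opens X}
    (hV : IsConformalHorizonOutside h (fun _ ↦ (1 : ℝ)) e V)
    (hne : (frontier (V : Set X)).Nonempty) :
    IsMinimalSurfaceImage h (frontier (V : Set X)) := by
  obtain ⟨S', t, c, m, k, t2, f', ν', hpb', hf', -, hν', hνs, hout, hhor⟩ := hV
  have hfr : frontier (V : Set X) = range f' := hout.frontier_eq
  haveI : Nonempty S' := by
    obtain ⟨x, hx⟩ := hne
    rw [hfr] at hx
    obtain ⟨y, -⟩ := hx
    exact ⟨y⟩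
  rw [hfr]
  exact ⟨S', t, c, m, k, t2, ‹_›, f', ν', hpb', hf', hν', hνs,
    (isConformalHorizon_one_iff h f' ν' hpb' hf').1 hhor, rfl⟩

variable [T2Space X] [LocallyCompactSpace X] [MeasurableSpace X] [BorelSpace X]
  {U₀ : Opens X} {u v : ℝ → X → ℝ} {U : ℝ → Opens X}

/-- **`Σ(0) = Σ⁺(0)` is the image of a compact minimal surface of `(X, g₀)`** (when nonempty):
by Thm. 2 at `t = 0`, `Σ(0) = frontier (U 0)` is a smooth horizon of `(X, g₀)` (`u₀ ≡ 1`) of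
class `𝒮`. Bray 2001, Thm. 2 and §4, Thm. 7 (`Σ(t) = Σ⁺(t)` is a horizon in `(M³, g_t)`).
[cite: BrayRPI2001, Thm. 2 and §4 Thm. 7] -/
theorem IsConformalFlow.isMinimalSurfaceImage_frontier_zero (F : IsConformalFlow h e U₀ u v U)
    (hne : (frontier (U 0 : Set X)).Nonempty) :
    IsMinimalSurfaceImage h (frontier (U 0 : Set X)) := by
  have h0 := F.horizon 0 le_rfl
  rw [F.u_zero] at h0
  exact h0.isMinimalSurfaceImage_frontier hne

/-- **`Σ(0) = Σ₀` when `Σ₀` bounds an exterior region.** Let the flow start at `Σ₀ = ∂U₀` with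
`U₀` (pre)connected, and suppose that every image of a compact immersed minimal surface of
`(X, h)` contained in `closure U₀` lies in `∂U₀` (the exterior-region hypothesis (iii) of
Huisken–Ilmanen's Main Theorem, as in `Bray2001_capacity_eq_of_penrose_eq`). Then `U 0 = U₀`:
`Σ(0) ⊆ closure (U 0) ⊆ closure U₀` is such an image (or empty), hence `Σ(0) ⊆ ∂U₀` does not
meet `U₀`, so the nonempty open set `U 0 ⊆ U₀` (an exterior region of the end) is relatively
closed in the connected `U₀`. This is the identification "`Σ⁺(0)` … is the outermost horizon"
of Bray's §13 in the exterior-region encoding.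
[cite: BrayRPI2001, §13, proof of the case of equality (Σ⁺(0) is the outermost horizon)]
[cite: HuiskenIlmanenIMCF2001, Main Theorem (iii)] -/
theorem IsConformalFlow.init_eq_zero_of_forall_isMinimalSurfaceImage
    (F : IsConformalFlow h e U₀ u v U) (hconn : IsPreconnected (U₀ : Set X))
    (hiii : ∀ N, IsMinimalSurfaceImage h N → N ⊆ closure (U₀ : Set X) →
      N ⊆ frontier (U₀ : Set X)) :
    U 0 = U₀ := by
  have hle : (U 0 : Set X) ⊆ (U₀ : Set X) := F.le_init le_rfl
  -- `Σ(0) ⊆ ∂U₀`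
  have hfr : frontier (U 0 : Set X) ⊆ frontier (U₀ : Set X) := by
    rcases (frontier (U 0 : Set X)).eq_empty_or_nonempty with h0 | hne
    · simp [h0]
    · exact hiii _ (F.isMinimalSurfaceImage_frontier_zero hne)
        (frontier_subset_closure.trans (closure_mono hle))
  -- `U 0` is nonempty (an exterior region of the end)
  have hne : ((U₀ : Set X) ∩ (U 0 : Set X)).Nonempty := by
    rw [inter_eq_right.2 hle]
    exact ((F.isCalS le_rfl).isExteriorRegion h).nonempty
  -- `closure (U 0) ∩ U₀ ⊆ U 0`, as `Σ(0)` does not meet the open `U₀`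
  have hcl : closure (U 0 : Set X) ∩ (U₀ : Set X) ⊆ (U 0 : Set X) := by
    rintro x ⟨hx, hxU₀⟩
    rw [closure_eq_self_union_frontier] at hx
    rcases hx with hx | hx
    · exact hx
    · exact ((disjoint_frontier_iff_isOpen.mpr U₀.isOpen).le_bot ⟨hfr hx, hxU₀⟩).elim
  exact le_antisymm (F.le_init le_rfl)
    (hconn.subset_of_closure_inter_subset (U 0).isOpen hne hcl)

end Initial

/-! ### The calculus of §13: a nonincreasing function attaining its lower bound at `0` -/

/-- If `m` is nonincreasing on `[0, ∞)` and `m(0) ≤ m(t)` for all `t ≥ 0`, then `m` is constant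
on `[0, ∞)`, so a right-hand derivative `d` of `m` at `0` vanishes. (Bray 2001, §13: equality in
(226) for all `t ≥ 0` and `m(t)` nonincreasing give "the right hand derivative of `m(t)` at `t = 0`
equals zero".) [cite: BrayRPI2001, §13, proof of the case of equality] -/
theorem eq_zero_of_hasDerivWithinAt_of_antitoneOn {m : ℝ → ℝ} {d : ℝ}
    (hanti : AntitoneOn m (Ici 0)) (hlow : ∀ t, 0 ≤ t → m 0 ≤ m t)
    (hd : HasDerivWithinAt m d (Ioi 0) 0) : d = 0 := by
  -- `m` is constant on `[0, ∞)`
  have hconst : ∀ t, 0 ≤ t → m t = m 0 := fun t ht ↦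
    le_antisymm (hanti Set.self_mem_Ici (Set.mem_Ici.2 ht) ht) (hlow t ht)
  rw [hasDerivWithinAt_Ioi_iff_Ici] at hd
  have hc : HasDerivWithinAt (fun _ : ℝ ↦ m 0) 0 (Ici 0) 0 := hasDerivWithinAt_const _ _ _
  have hm : HasDerivWithinAt m 0 (Ici 0) 0 := by
    refine hc.congr_of_eventuallyEq ?_ (by simp)
    filter_upwards [self_mem_nhdsWithin] with t ht
    exact hconst t ht
  exact (uniqueDiffOn_Ici 0).uniqueDiffWithinAt Set.self_mem_Ici |>.eq_deriv _ hd hm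

/-! ### `ℰ(Σ⁺(0), g₀) = 2 m(0)` in the case of equality -/

/-- **The arithmetic of Bray's §13 paragraph.** Let `A(t) = A₀` for `t ≥ 0` (Thm. 3: `A(t)` is
constant), let `m` be nonincreasing on `[0, ∞)` (Thm. 3) with `m(t) ≥ √(A(t)/16π)` for `t ≥ 0`
((226)) and right-hand derivative `d m/dt⁺|_{t=0} = c - 2 m(0)` (§7, `c = ℰ(Σ⁺(0), g₀)`). If
`√(A₀/16π) = m(0)` (equality in the Penrose inequality), then *"[the flow] must also give
equality in inequality (226) for all `t ≥ 0`. Hence, the right hand derivative of `m(t)` at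
`t = 0` equals zero, so"* `c = 2 m(0)`. Areas in `ℝ≥0∞` enter through `ENNReal.toReal`, as in
`HasConformalFlowHF`. [cite: BrayRPI2001, §13, proof of the case of equality (after Thm. 18)] -/
theorem half_eq_of_hasDerivWithinAt_of_penrose_eq {A : ℝ → ℝ≥0∞} {A₀ : ℝ≥0∞} {m : ℝ → ℝ}
    {c : ℝ} (hA : ∀ t, 0 ≤ t → A t = A₀) (hanti : AntitoneOn m (Ici 0))
    (h226 : ∀ t, 0 ≤ t → Real.sqrt ((A t).toReal / (16 * π)) ≤ m t)
    (hmprime : HasDerivWithinAt m (c - 2 * m 0) (Ioi 0) 0)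
    (heq : Real.sqrt (A₀.toReal / (16 * π)) = m 0) : c / 2 = m 0 := by
  -- equality in (226) for all `t ≥ 0`: `m(0) = √(A₀/16π) = √(A(t)/16π) ≤ m(t) ≤ m(0)`
  have hlow : ∀ t, 0 ≤ t → m 0 ≤ m t := by
    intro t ht
    calc m 0 = Real.sqrt (A₀.toReal / (16 * π)) := heq.symm
      _ = Real.sqrt ((A t).toReal / (16 * π)) := by rw [hA t ht]
      _ ≤ m t := h226 t ht
  -- hence the right-hand derivative of `m` at `0` vanishes
  have h0 := eq_zero_of_hasDerivWithinAt_of_antitoneOn hanti hlow hmprime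
  linarith

section Equality

variable {h : ContMDiffRiemannianMetric (𝓡 3) ∞ E3 (TangentSpace (𝓡 3) : X → Type _)}
  [(ofRiemannian h).HasLeviCivita] [T2Space X] [LocallyCompactSpace X] [MeasurableSpace X]
  [BorelSpace X] {e : AFEnd X} {U₀ : Opens X} {u v : ℝ → X → ℝ} {U : ℝ → Opens X}

/-- **Equality in the Penrose inequality forces `ℰ(Σ₀, g₀) = 2 m(0)`, for `Σ₀` bounding an
exterior region** (Bray, J. Differential Geom. 59 (2001), §13, proof of the case of equality,
first half, machine-checked on the flow vocabulary). Let `(u_t, v_t, Σ(t) = frontier (U t))` be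
a conformal flow of `(X, g₀ = h)` from `Σ₀ = frontier U₀` with the properties of Thm. 2
(`IsConformalFlow`; Thm. 18 for asymptotically flat data), with `A(t) = |Σ₀|_{g₀}` for `t ≥ 0`
(Thm. 3 with §4 Lemma 5), and let `m(t)` — the total masses of `(X, g_t)`, Def. 8 resp. (225) —
be nonincreasing on `[0, ∞)` (Thm. 3), satisfy (226) `m(t) ≥ √(A(t)/16π)` for `t ≥ 0`, and have
right-hand derivative `d m/dt⁺|_{t=0} = ℰ(Σ⁺(0), g₀) - 2 m(0)` at `0` (§7, the display
preceding Thm. 10, with Cor. 4), where `Σ⁺(0) = Σ(0)` (§4 Def. 11 and Thm. 7) has outside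
region `U 0` and `ℰ = horizonCapacity h e (U 0)` is its capacity (Def. 17). Suppose `U₀` is
connected and every image of a compact immersed minimal surface in `closure U₀` lies in `∂U₀`,
so that
`Σ⁺(0) = Σ(0) = Σ₀` (`init_eq_zero_of_forall_isMinimalSurfaceImage`; Bray: *"`Σ⁺(0)` is the
outermost minimal area enclosure of `Σ₀` … Hence, `Σ⁺(0)` is the outermost horizon"*). If
`√(|Σ₀|_{g₀}/16π) = m(0)`, then `ℰ(Σ₀, g₀) = 2 m(0)`: `(horizonCapacity h e U₀).toReal / 2 = m 0`
(`half_eq_of_hasDerivWithinAt_of_penrose_eq`). Areas are the `2`-dimensional Hausdorff areas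
`area h`, `flowArea h u U` of `Volume.lean`/`ConformalFlow.lean`.
[cite: BrayRPI2001, §13, proof of the case of equality (after Thm. 18), with (226) and §7 (derivative formula before Thm. 10)]
[cite: HuiskenIlmanenIMCF2001, Main Theorem (iii)] -/
theorem IsConformalFlow.horizonCapacity_toReal_div_two_eq_of_forall_isMinimalSurfaceImage
    (F : IsConformalFlow h e U₀ u v U) (hconn : IsPreconnected (U₀ : Set X))
    (hiii : ∀ N, IsMinimalSurfaceImage h N → N ⊆ closure (U₀ : Set X) →
      N ⊆ frontier (U₀ : Set X))
    (hA : ∀ t, 0 ≤ t → flowArea h u U t = area h (frontier (U₀ : Set X))) {m : ℝ → ℝ}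
    (hanti : AntitoneOn m (Ici 0))
    (h226 : ∀ t, 0 ≤ t → Real.sqrt ((flowArea h u U t).toReal / (16 * π)) ≤ m t)
    (hmprime : HasDerivWithinAt m ((horizonCapacity h e (U 0)).toReal - 2 * m 0) (Ioi 0) 0)
    (heq : Real.sqrt ((area h (frontier (U₀ : Set X))).toReal / (16 * π)) = m 0) :
    (horizonCapacity h e U₀).toReal / 2 = m 0 := by
  rw [← F.init_eq_zero_of_forall_isMinimalSurfaceImage hconn hiii]
  exact half_eq_of_hasDerivWithinAt_of_penrose_eq hA hanti h226 hmprime heq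

/-- **Equality in the Penrose inequality forces `ℰ(Σ₀, g₀) = 2 m(0)`, for `Σ₀ ∈ 𝒮` strictly
outer-minimizing**: as
`IsConformalFlow.horizonCapacity_toReal_div_two_eq_of_forall_isMinimalSurfaceImage`, with
`Σ(0) = Σ₀` because a strictly outer-minimizing surface of `𝒮` is its own only minimal area
enclosure (`IsConformalFlow.init_eq_zero`; Bray 2001, §3 and §2 Def. 6).
[cite: BrayRPI2001, §13, proof of the case of equality (after Thm. 18), with §3 and §2 Def. 6] -/
theorem IsConformalFlow.horizonCapacity_toReal_div_two_eq_of_isStrictlyOuterMinimizing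
    (F : IsConformalFlow h e U₀ u v U) (hU₀ : IsCalS h e U₀)
    (hmin : IsStrictlyOuterMinimizing h (fun _ ↦ (1 : ℝ)) e U₀)
    (hA : ∀ t, 0 ≤ t → flowArea h u U t = area h (frontier (U₀ : Set X))) {m : ℝ → ℝ}
    (hanti : AntitoneOn m (Ici 0))
    (h226 : ∀ t, 0 ≤ t → Real.sqrt ((flowArea h u U t).toReal / (16 * π)) ≤ m t)
    (hmprime : HasDerivWithinAt m ((horizonCapacity h e (U 0)).toReal - 2 * m 0) (Ioi 0) 0)
    (heq : Real.sqrt ((area h (frontier (U₀ : Set X))).toReal / (16 * π)) = m 0) :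
    (horizonCapacity h e U₀).toReal / 2 = m 0 := by
  rw [← F.init_eq_zero hU₀ hmin]
  exact half_eq_of_hasDerivWithinAt_of_penrose_eq hA hanti h226 hmprime heq

end Equality

/-! ### The assembly in the exterior-region encoding of `Bray2001_capacity_eq_of_penrose_eq` -/

section ExteriorRegion

variable [T2Space X] [LocallyCompactSpace X] [MeasurableSpace X] [BorelSpace X]
  (D : InitialDataSet (𝓡 3) X) [D.metric.HasLeviCivita] (e : AFEnd X)

/-- **Bray's §13 step `ℰ(∂M', g) = 2m` for an exterior region, assembled from the flow.** Let
`U` be an exterior region of the end `e` (`IsExteriorRegion`: connected, one-ended, compact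
modulo the end) with compact minimal boundary `∂U = range B.f` (`B : MinimalBoundary D.h U`) such
that every image of a compact immersed minimal surface in `closure U` lies in `∂U` (hypothesis
(iii) of `Bray2001_capacity_eq_of_penrose_eq`), and suppose equality `√(|Σ₀|/16π) = m`,
`m := e.admEnergy D`, for a quantity `|Σ₀| ≤ |∂U|` (`|∂U| = area D.h (range B.f)`; for a compact
surface `Σ₀` smoothly embedded into `∂U`, `|Σ₀| = totalArea (f₀^* h)` as in the named fact, this
is the area formula, Federer 1969, §3.2.46, and monotonicity of the area). Suppose the data
carry a conformal flow `(u_t, v_t, Σ(t))` from `Σ₀' := ∂U` as in Thm. 2 (Thm. 18: Thm. 2 holds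
for asymptotically flat manifolds; this requires `∂U ∈ 𝒮`) with `A(t) = |∂U|` (Thm. 18 with
Thm. 3 and §4 Lemma 5) and total masses `m(t)` ((225) for `g_t = u_t⁴ h`) with `m(0) = m`,
nonincreasing on `[0, ∞)` (Thm. 18 with Thm. 3), satisfying (226) and the derivative formula
of §7 at `t = 0`. Then `ℰ(∂U, g)/2 = m`: `(horizonCapacity D.h e U).toReal / 2 = e.admEnergy D`,
the conclusion of `Bray2001_capacity_eq_of_penrose_eq`. Proof: `16π m² = |Σ₀| ≤ |∂U| = A(0)` and
(226) at `t = 0` give equality `√(|∂U|/16π) = m(0)`; then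
`IsConformalFlow.horizonCapacity_toReal_div_two_eq_of_forall_isMinimalSurfaceImage`.
[cite: BrayRPI2001, §13, proof of the case of equality (after Thm. 18), with Thm. 18, (226), §7 (derivative formula before Thm. 10) and Thm. 19]
[cite: HuiskenIlmanenIMCF2001, Main Theorem (iii)] -/
theorem horizonCapacity_toReal_div_two_eq_admEnergy_of_isConformalFlow {U : Opens X}
    (B : MinimalBoundary D.h (U : Set X)) (hU : IsExteriorRegion e U)
    (hiii : ∀ N, IsMinimalSurfaceImage D.h N → N ⊆ closure (U : Set X) → N ⊆ range B.f)
    {A₀ : ℝ≥0∞} (hA₀ : A₀.toReal ≤ (area D.h (range B.f)).toReal)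
    (heq : Real.sqrt (A₀.toReal / (16 * π)) = e.admEnergy D)
    {u v : ℝ → X → ℝ} {U' : ℝ → Opens X} (F : IsConformalFlow D.h e U u v U')
    (hA : ∀ t, 0 ≤ t → flowArea D.h u U' t = area D.h (frontier (U : Set X))) {m : ℝ → ℝ}
    (hm0 : m 0 = e.admEnergy D) (hanti : AntitoneOn m (Ici 0))
    (h226 : ∀ t, 0 ≤ t → Real.sqrt ((flowArea D.h u U' t).toReal / (16 * π)) ≤ m t)
    (hmprime : HasDerivWithinAt m ((horizonCapacity D.h e (U' 0)).toReal - 2 * m 0) (Ioi 0) 0) :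
    (horizonCapacity D.h e U).toReal / 2 = e.admEnergy D := by
  have hfr : frontier (U : Set X) = range B.f := B.frontier_eq
  -- equality for `∂U` itself: `m = √(|Σ₀|/16π) ≤ √(|∂U|/16π) = √(A(0)/16π) ≤ m(0) = m`
  have hle : Real.sqrt (A₀.toReal / (16 * π)) ≤
      Real.sqrt ((area D.h (frontier (U : Set X))).toReal / (16 * π)) := by
    rw [hfr]
    exact Real.sqrt_le_sqrt (div_le_div_of_nonneg_right hA₀ (by positivity))
  have hge : Real.sqrt ((area D.h (frontier (U : Set X))).toReal / (16 * π)) ≤ m 0 := by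
    have h0 := h226 0 le_rfl
    rwa [hA 0 le_rfl] at h0
  have heq' : Real.sqrt ((area D.h (frontier (U : Set X))).toReal / (16 * π)) = m 0 :=
    le_antisymm hge (by rw [hm0, ← heq]; exact hle)
  rw [← hm0]
  refine F.horizonCapacity_toReal_div_two_eq_of_forall_isMinimalSurfaceImage
    hU.isConnected.isPreconnected ?_ hA hanti h226 hmprime heq'
  intro N hN hNU
  rw [hfr]
  exact hiii N hN hNU

end ExteriorRegion

end Literature.Geometry.Lorentzian

end
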